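import Literature.NumberTheory.EllipticCurves.GeomReductionFrobeniusProofs
import Summits.BirchSwinnertonDyer.BirchSwinnertonDyer.Theorems.GenusKolyvaginAtTwoGenusDeepSupplyAtTwoNegDiscNarrowDepthZeroCriterion
import HarnessLib

/-!
# Route `GenusKolyvaginAtTwo`, crux 25504 (Δ>0 supply `GenusPrimitiveSupplyAtTwoPosDiscShallow`), registered stub C⁺‴ / kernel K₄⁺:
# TRANSPOSITION-TYPE («swap-type») FROBENIUS ELEMENTS READ THE POSITIVE-DEPTH BIT OF `y_K`; ELEMENTS TRIVIAL ON `E[2]` ARE BLIND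

Seat `bsd-line-gk2-p5` g35 (cell `bsd-f1-sign2`, WIDTH-5 attach), `--supports stmt-BirchSwinnertonDyer-25504 --as helper`.  THEOREMS ONLY (no
definition, no named fact, no `sorry`); sign-free in `Δ_E`.  **BSD is NOT proved by this file, no item is closed, the registered stubs are untouched.**

WHY (answer, structure-side, to cdisprove g0's CENSUS FLAG §2 in `Cruxes/GenusPrimitiveSupplyAtTwoPosDiscShallow/Disproof.lean`: «K₄⁺'s deep primes —
Frobenius a TRANSPOSITION on `E[2]`, `4 ∣ ℓ+1`, `4 ∣ a_ℓ` — are not Kolyvagin primes in the Frobenius sense `Frob_ℓ ∼ τ` at any level when `Δ > 0`»).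
Kolyvagin's mechanism at a deep prime `λ = (ℓ)` of `K` needs ONE thing from `Frob_ℓ` beyond `ℓ` inert, `2^M ∣ ℓ+1`, `2^M ∣ a_ℓ`: that the reduction
`red_λ` can SEE the point `w := y_K / 2^{M₀} ∈ E(K)` (`2^{M₀} ∥ y_K`), i.e. that «`red_λ w ∈ 2Ẽ(𝔽_λ)`, `𝔽_λ = 𝔽_{ℓ²}`» is a genuine bit.  This file
computes that bit for an ARBITRARY `σ ∈ Γ_ℚ` playing `Frob_ℓ` against the abstract frame of the point: `w, w′, t ∈ E(ℚ̄)` with `2w′ = w`,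
`σ•w = −w + t`, `σ•t = t`, `t` of odd order (instantiation: `w = y_K/2^{M₀} ∈ E(K)` — in `E(K)` because `E(K[1])[2^∞] = 0` —, `σ|_K = τ` as `ℓ` is
inert, `τw = −w +` odd torsion since `y_K + τy_K ∈ E(ℚ)` is torsion on the rank-`0` habitat and `E(K)[2] = 0`):

* §1 (Galois-module algebra) with `s` = the half of `t` and the DEFECT `t₁ := σ•w′ + w′ − s`: `2•t₁ = 0` (`two_smul_swapDefect_eq_zero`) and
  **`σ•σ•w′ = w′ + (σ•t₁ + t₁)`** (`smul_smul_half_eq_add_bit`); the same for every other half `w′ + T`, `T ∈ E[2]` with `σ²T = T`.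
* §2 DICHOTOMY: if `σ` is TRIVIAL on `E[2]` the bit `σ•t₁ + t₁ = 2t₁` VANISHES IDENTICALLY (`bit_eq_zero_of_smul_torsion_eq_self`) — on `Δ > 0` the
  classical `τ`-type primes (`Frob_ℓ ∼ τ`, `τ|E[2] = 1` as `E[2] ⊂ E(ℝ)`) are BLIND at positive depth, the structural reason the line uses cyclic-
  reduction primes; if `σ` MOVES a point `u ∈ E[2]` then `σ•u + u ≠ 0` (`smul_add_self_ne_zero_of_smul_ne`), so translating `w′` by `u` FLIPS the bit:
  `t₁(σh) = t₁(σ) + σ•T` for `h•w′ = w′ + T`, `h•t = t` (`swapDefect_mul`), and **`bit(σh) = bit(σ) + (σ•T + T)`** when `h` is trivial on `E[2]`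
  (`bit_mul_eq_add`) — BOTH values of the bit occur in the coset `σ · Γ_{ℚ(E[2],…)}` as soon as the Kummer translations of `w′` exhaust `E[2]`
  (`exists_bit_ne_zero_of_kummer`): full Chebotarev freedom at swap type, exactly as for `τ`-type primes on `Δ < 0` (where `τ|E[2]` IS a transposition).
* §3 READING THROUGH REDUCTION at an arithmetic Frobenius `σ` at the place prime `𝔓 ∣ p`, `p` an odd good prime (`red = geomReduction`, `φ` = the
  `p`-Frobenius of `𝔽̄_p`, tree `geomReduction_smul_of_isArithFrobAt`): `φ²•red w′ = red w′ + red(σ•t₁ + t₁)` and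
  **`(∃ R ∈ Ẽ(𝔽̄_p), φ²•R = R ∧ 2R = red w) ↔ σ•t₁ + t₁ = 0`** (`exists_frobSq_fixed_half_iff_bit_eq_zero`: «`red w ∈ 2Ẽ(𝔽_{p²})` ⟺ bit off»;
  `red` maps `E[2]` ONTO `Ẽ[2]` for odd good `p`, `exists_two_torsion_geomReduction_eq`).
* §4 `smul_smul_eq_self_of_even_frobeniusTrace` — at a prime with `a_p` EVEN (every Zhang–Kolyvagin prime at `2`) `σ²` is trivial on `E[2]`
  (Manin's relation `φ² − a_pφ + p = 0` on `Ẽ[2]`), so §1–§3 apply with no extra hypothesis.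

READING for the LEAD / pen / -data.  On the `M₀ ≥ 1` cells (K₄, K₄⁺) the object Kolyvagin's descent localises at a deep prime is `w = y_K/2^{M₀}`;
its visibility bit at `λ` is `(1+Frob_ℓ)t₁`.  Δ<0: `τ`-type = transposition-type, bit live.  Δ>0: `τ`-type is BLIND (bit ≡ 0), transposition-type
(the registered K₄⁺ clause `∃ u : E[2], Frob•u ≠ u`) is LIVE with both values realised — so K₄⁺'s prime class is the UNIQUE class at `2` on which
the positive-depth mechanism can run when `Δ > 0`, and locally at `ℓ` it is indistinguishable from K₄'s.  Instrument I3⁺ (-data): at a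
transposition-deep `ℓ`, is `red_λ(y_K/2^{M₀}) ∈ 2Ẽ(𝔽_{ℓ²})`?  Nothing here proves K₄⁺, the structure theorem at `2`, or BSD.

References: [GrossLMS1991] §3 Prop. 3.7, §4 (4.1), §6 Prop. 6.2; [McCallumLMS1991] §4–§5; [Kolyvagin1991MathAnn] §1; [Serre1972] §1.11 Prop. 11;
[SilvermanAEC2009] V.2.3.1, VII.3.1(b), III.6.4(b).
-/

set_option autoImplicit false
set_option linter.dupNamespace false -- `Summit.<P>.<Sub>` repeats `BirchSwinnertonDyer` (D-0017)

noncomputable section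

open scoped Classical NumberField Pointwise

namespace Summit.BirchSwinnertonDyer.BirchSwinnertonDyer.Theorems.GenusSupplyNarrow.SwapRead

open IsDedekindDomain Field WeierstrassCurve Literature.NumberTheory.EllipticCurves Literature.NumberTheory.GaloisRepresentations
  Rat.HeightOneSpectrum Summit.BirchSwinnertonDyer.BirchSwinnertonDyer.Theorems.GenusSupplyNarrow

/-! ## §1 The positive-depth bit of a `σ`-anti-invariant point: `σ²w′ = w′ + (σ t₁ + t₁)` -/

section Algebra

variable {W : WeierstrassCurve ℚ} (σ : absoluteGaloisGroup ℚ) {w w' t : W.geomPoints}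

/-- **The defect `t₁ := σ•w′ + w′ − s` is `2`-torsion** (`2w′ = w`, `σw = −w + t`, `s` the half of the odd-order `t`):
`2t₁ = σw + w − t = 0`. [cite: GrossLMS1991, §4 (4.1), §3 Prop. 3.7] -/
theorem two_smul_swapDefect_eq_zero (hw' : (2 : ℤ) • w' = w) (hσw : σ • w = -w + t) (hodd : Odd (addOrderOf t)) :
    (2 : ℤ) • (σ • w' + w' - (((addOrderOf t + 1) / 2 : ℕ) : ℤ) • t) = 0 := by
  have h2s := two_smul_half_of_odd_addOrderOf hodd
  rw [smul_sub, smul_add, ← smul_zsmul_geomPoints', hw', hσw, h2s]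
  abel

/-- **`σ²w′ = w′ + (σ•t₁ + t₁)`** for the defect `t₁ = σ•w′ + w′ − s` (`σ•t = t`, so `σ•s = s`; `2w′ = w`, `σw = −w + t`, `2s = t`).
The element `σ•t₁ + t₁ ∈ E[2]` is THE POSITIVE-DEPTH BIT of `w` at `σ`. [cite: GrossLMS1991, §4 (4.1), §6 Prop. 6.2 (proof)] -/
theorem smul_smul_half_eq_add_bit (hw' : (2 : ℤ) • w' = w) (hσw : σ • w = -w + t) (ht : σ • t = t)
    (hodd : Odd (addOrderOf t)) :
    σ • (σ • w') = w' + (σ • (σ • w' + w' - (((addOrderOf t + 1) / 2 : ℕ) : ℤ) • t) +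
      (σ • w' + w' - (((addOrderOf t + 1) / 2 : ℕ) : ℤ) • t)) := by
  have h2s := two_smul_half_of_odd_addOrderOf hodd
  set s : W.geomPoints := (((addOrderOf t + 1) / 2 : ℕ) : ℤ) • t with hs
  have hσs : σ • s = s := by rw [hs, smul_zsmul_geomPoints', ht]
  -- `σ•t₁ + t₁ = σ²w′ + 2•σw′ + w′ − 2s = σ²w′ + σw + w′ − t = σ²w′ − w + w′`
  have h2σ : σ • w' + σ • w' = -w + t := by rw [← two_smul ℤ, ← smul_zsmul_geomPoints', hw', hσw]
  have hss : s + s = t := by rw [← two_smul ℤ, h2s]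
  have hww : w' + w' = w := by rw [← two_smul ℤ, hw']
  rw [smul_sub, smul_add, hσs]
  -- goal: σ σ w' = w' + (σ σ w' + σ w' - s + (σ w' + w' - s))
  have key : σ • (σ • w') + σ • w' - s + (σ • w' + w' - s) = σ • (σ • w') + (σ • w' + σ • w') + w' - (s + s) := by abel
  rw [key, h2σ, hss, ← hww]
  abel

/-- The same bit for EVERY half of `w`: for `T` with `σ²T = T` (e.g. any `T ∈ E[2]` when `σ²` is trivial on `E[2]`),
**`σ²(w′ + T) = (w′ + T) + (σ•t₁ + t₁)`**. [cite: GrossLMS1991, §6 Prop. 6.2 (proof)] -/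
theorem smul_smul_half_add_eq_add_bit (hw' : (2 : ℤ) • w' = w) (hσw : σ • w = -w + t) (ht : σ • t = t)
    (hodd : Odd (addOrderOf t)) {T : W.geomPoints} (hσσT : σ • (σ • T) = T) :
    σ • (σ • (w' + T)) = (w' + T) + (σ • (σ • w' + w' - (((addOrderOf t + 1) / 2 : ℕ) : ℤ) • t) +
      (σ • w' + w' - (((addOrderOf t + 1) / 2 : ℕ) : ℤ) • t)) := by
  rw [smul_add, smul_add, hσσT, smul_smul_half_eq_add_bit σ hw' hσw ht hodd]
  abel

end Algebra

/-! ## §2 Dichotomy: elements trivial on `E[2]` are blind; elements moving a point of `E[2]` flip the bit under Kummer translation -/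

section Dichotomy

variable {W : WeierstrassCurve ℚ} (σ : absoluteGaloisGroup ℚ) {w w' t : W.geomPoints}

/-- **BLINDNESS**: if `σ` fixes every `2`-torsion point of `E(ℚ̄)` then the bit vanishes — `σ•t₁ + t₁ = 2t₁ = 0` — so `σ²` FIXES the half `w′`
(and every half): on `Δ > 0` a `τ`-type Frobenius (`τ|E[2] = 1`) never sees `y_K/2^{M₀}`. [cite: GrossLMS1991, §6 Prop. 6.2] -/
theorem bit_eq_zero_of_smul_torsion_eq_self (hfix : ∀ T : W.geomPoints, (2 : ℤ) • T = 0 → σ • T = T)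
    (hw' : (2 : ℤ) • w' = w) (hσw : σ • w = -w + t) (hodd : Odd (addOrderOf t)) :
    σ • (σ • w' + w' - (((addOrderOf t + 1) / 2 : ℕ) : ℤ) • t) +
      (σ • w' + w' - (((addOrderOf t + 1) / 2 : ℕ) : ℤ) • t) = 0 := by
  have h2 := two_smul_swapDefect_eq_zero σ hw' hσw hodd
  rw [hfix _ h2, ← two_smul ℤ, h2]

/-- … hence `σ²w′ = w′` for such `σ`. [cite: GrossLMS1991, §6 Prop. 6.2] -/
theorem smul_smul_half_eq_self_of_smul_torsion_eq_self (hfix : ∀ T : W.geomPoints, (2 : ℤ) • T = 0 → σ • T = T)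
    (hw' : (2 : ℤ) • w' = w) (hσw : σ • w = -w + t) (ht : σ • t = t) (hodd : Odd (addOrderOf t)) :
    σ • (σ • w') = w' := by
  rw [smul_smul_half_eq_add_bit σ hw' hσw ht hodd, bit_eq_zero_of_smul_torsion_eq_self σ hfix hw' hσw hodd, add_zero]

omit σ in
/-- A `2`-torsion point MOVED by `σ` has `σ•u + u ≠ 0` (`σ•u + u = σ•u − u`). [folklore] -/
theorem smul_add_self_ne_zero_of_smul_ne (σ : absoluteGaloisGroup ℚ) {u : W.geomPoints} (hu2 : (2 : ℤ) • u = 0) (hu : σ • u ≠ u) :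
    σ • u + u ≠ 0 := by
  intro h
  apply hu
  have hneg : -u = u := by
    rw [neg_eq_iff_add_eq_zero, ← two_smul ℤ, hu2]
  exact (eq_neg_of_add_eq_zero_left h).trans hneg

/-- **KUMMER TRANSLATION MOVES THE DEFECT BY `σ•T`**: if `h•w′ = w′ + T` and `h•t = t` then the defect of `σh` is `t₁(σ) + σ•T`
(`(σh)•w = σ•w` automatically, as `2T = 0` is not even needed for this identity). [cite: GrossLMS1991, §4 (Kummer theory of `y_K`)] -/
theorem swapDefect_mul (h : absoluteGaloisGroup ℚ) {T : W.geomPoints} (hhw : h • w' = w' + T) (hht : h • t = t) :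
    (σ * h) • w' + w' - (((addOrderOf t + 1) / 2 : ℕ) : ℤ) • t =
      (σ • w' + w' - (((addOrderOf t + 1) / 2 : ℕ) : ℤ) • t) + σ • T := by
  have _ := hht
  rw [mul_smul, hhw, smul_add]
  abel

/-- **THE BIT FLIPS BY `σ•T + T`** (`h` trivial on `E[2]`, `h•w′ = w′ + T` with `σ²`… precisely: `(σh)•x = σ•x` for the `2`-torsion values involved):
`bit(σh) = bit(σ) + (σ•(σ•T) + σ•T)`; if moreover `σ²T = T` this is `bit(σ) + (σ•T + T)`. [cite: GrossLMS1991, §4, §6] -/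
theorem bit_mul_eq_add (h : absoluteGaloisGroup ℚ) {T : W.geomPoints} (hhw : h • w' = w' + T) (hht : h • t = t)
    (hfixh : ∀ U : W.geomPoints, (2 : ℤ) • U = 0 → h • U = U)
    (hw' : (2 : ℤ) • w' = w) (hσw : σ • w = -w + t) (hodd : Odd (addOrderOf t)) (hT : (2 : ℤ) • T = 0) (hσσT : σ • (σ • T) = T) :
    (σ * h) • ((σ * h) • w' + w' - (((addOrderOf t + 1) / 2 : ℕ) : ℤ) • t) +
        ((σ * h) • w' + w' - (((addOrderOf t + 1) / 2 : ℕ) : ℤ) • t) =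
      (σ • (σ • w' + w' - (((addOrderOf t + 1) / 2 : ℕ) : ℤ) • t) +
        (σ • w' + w' - (((addOrderOf t + 1) / 2 : ℕ) : ℤ) • t)) + (σ • T + T) := by
  have hd := swapDefect_mul σ h hhw hht
  rw [hd]
  -- `(σh)` acts on the `2`-torsion element `t₁ + σT` as `σ` (`h` trivial on `E[2]`)
  have h2t₁ := two_smul_swapDefect_eq_zero σ hw' hσw hodd
  have h2σT : (2 : ℤ) • (σ • T) = 0 := by rw [← smul_zsmul_geomPoints', hT, smul_zero]
  have h2sum : (2 : ℤ) • (σ • w' + w' - (((addOrderOf t + 1) / 2 : ℕ) : ℤ) • t + σ • T) = 0 := by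
    rw [smul_add, h2t₁, h2σT, add_zero]
  rw [mul_smul, hfixh _ h2sum, smul_add, hσσT]
  abel

/-- **BOTH VALUES OF THE BIT OCCUR IN THE COSET `σ·H`** (`H` = the elements trivial on `E[2]` and on `t`): if `σ` moves some `u ∈ E[2]` with
`σ²u = u` and the Kummer translations of `w′` by elements of `H` realise `u` (`∃ h ∈ H, h•w′ = w′ + u`), then there is `h ∈ H` for which the
bit of `σh` differs from the bit of `σ` — in particular ONE of `σ`, `σh` has NON-ZERO bit («reads `w` as `2`-indivisible mod `λ`») and one has
zero bit.  Transposition-type elements thus carry full Chebotarev freedom at positive depth. [cite: GrossLMS1991, §4, §6 Prop. 6.2] -/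
theorem exists_bit_ne_zero_of_kummer {u : W.geomPoints} (hu2 : (2 : ℤ) • u = 0) (hu : σ • u ≠ u) (hσσu : σ • (σ • u) = u)
    {h : absoluteGaloisGroup ℚ} (hhw : h • w' = w' + u) (hht : h • t = t) (hfixh : ∀ U : W.geomPoints, (2 : ℤ) • U = 0 → h • U = U)
    (hw' : (2 : ℤ) • w' = w) (hσw : σ • w = -w + t) (hodd : Odd (addOrderOf t)) :
    (σ • (σ • w' + w' - (((addOrderOf t + 1) / 2 : ℕ) : ℤ) • t) +
        (σ • w' + w' - (((addOrderOf t + 1) / 2 : ℕ) : ℤ) • t)) ≠ 0 ∨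
      ((σ * h) • ((σ * h) • w' + w' - (((addOrderOf t + 1) / 2 : ℕ) : ℤ) • t) +
        ((σ * h) • w' + w' - (((addOrderOf t + 1) / 2 : ℕ) : ℤ) • t)) ≠ 0 := by
  rw [or_iff_not_imp_left, not_ne_iff]
  intro h0 h1
  rw [bit_mul_eq_add σ h hhw hht hfixh hw' hσw hodd hu2 hσσu, h0, zero_add] at h1
  exact smul_add_self_ne_zero_of_smul_ne σ hu2 hu h1

end Dichotomy

/-! ## §3 Reading the bit through reduction at an arithmetic Frobenius -/

section Reduction

variable {p : ℕ} [Fact p.Prime] {W : WeierstrassCurve ℚ} [W.IsGloballyMinimal] [W.IsElliptic]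
  (hΔ : ¬ (p : ℤ) ∣ minimalDiscriminantInt W)
  {𝔓 : Ideal (absIntegers (𝓞 ℚ) ℚ)}
  (hmem : ∀ x : absIntegers (𝓞 ℚ) ℚ, x ∈ 𝔓 ↔ (x : AlgebraicClosure ℚ) ∈ (placeOver p).nonunits)
  {v : HeightOneSpectrum (𝓞 ℚ)} (hv : (primesEquiv v : ℕ) = p) (h𝔓 : 𝔓 ∈ v.primesAbove)
  {σ : absoluteGaloisGroup ℚ} (hσ : IsArithFrobAt (𝓞 ℚ) σ 𝔓)
  {φ : absoluteGaloisGroup (ZMod p)} (hφ : ∀ x : AlgebraicClosure (ZMod p), φ • x = x ^ p)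

omit [W.IsElliptic] in
include hΔ in
/-- **`red : E[2] → Ẽ[2]` is injective at an odd good prime** (`E[m] ↪ Ẽ` for `p ∤ m`, tree `eq_zero_of_smul_eq_zero_of_geomReduction_eq_zero`).
[cite: SilvermanAEC2009, Prop. VII.3.1(b)] -/
theorem geomReduction_eq_zero_of_two_smul (hp2 : p ≠ 2) {T : W.geomPoints} (hT : (2 : ℤ) • T = 0)
    (hred : geomReduction hΔ T = 0) : T = 0 := by
  have hm : ¬ p ∣ 2 := fun h ↦ hp2 ((Nat.prime_dvd_prime_iff_eq Fact.out Nat.prime_two).mp h)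
  exact eq_zero_of_smul_eq_zero_of_geomReduction_eq_zero hΔ hm (by rw [← natCast_zsmul]; exact_mod_cast hT) hred

include hΔ in
/-- **`red : E[2] → Ẽ[2]` is ONTO at an odd good prime** (hence a bijection): it is injective (above) between two groups of order `4`
(`#E[2](ℚ̄) = 4 = #Ẽ[2](𝔽̄_p)`, Silverman III.6.4(b), `p ≠ 2`), so every `2`-torsion point of `Ẽ(𝔽̄_p)` is the reduction of a `2`-torsion
point of `E(ℚ̄)`. [cite: SilvermanAEC2009, Prop. VII.3.1(b), Cor. III.6.4(b)] -/
theorem exists_two_torsion_geomReduction_eq (hp2 : p ≠ 2) (D : (reductionModPrime W p).geomPoints) (hD : (2 : ℤ) • D = 0) :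
    ∃ T : W.geomPoints, (2 : ℤ) • T = 0 ∧ geomReduction hΔ T = D := by
  haveI : (reductionModPrime W p).IsElliptic := isElliptic_reductionModPrime W hΔ
  -- the restriction of `red` to the `2`-torsion
  have hmap : ∀ T : W.geomTorsion ((2 : ℕ) : ℤ), geomReduction hΔ T.1 ∈ (reductionModPrime W p).geomTorsion ((2 : ℕ) : ℤ) := by
    intro T
    have h := AddSubgroup.torsionBy.nsmul_iff.mp T.2
    exact AddSubgroup.torsionBy.nsmul_iff.mpr (by rw [← map_nsmul, h, map_zero])
  set f : W.geomTorsion ((2 : ℕ) : ℤ) → (reductionModPrime W p).geomTorsion ((2 : ℕ) : ℤ) :=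
    fun T ↦ ⟨geomReduction hΔ T.1, hmap T⟩ with hf
  have hinj : Function.Injective f := by
    intro T₁ T₂ h12
    have h12' : geomReduction hΔ T₁.1 = geomReduction hΔ T₂.1 := congrArg Subtype.val h12
    have hsub : geomReduction hΔ (T₁.1 - T₂.1) = 0 := by rw [map_sub, h12', sub_self]
    have h₁ : (2 : ℤ) • T₁.1 = 0 := by
      have h := AddSubgroup.torsionBy.nsmul_iff.mp T₁.2
      rwa [← natCast_zsmul] at h
    have h₂ : (2 : ℤ) • T₂.1 = 0 := by
      have h := AddSubgroup.torsionBy.nsmul_iff.mp T₂.2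
      rwa [← natCast_zsmul] at h
    have h2 : (2 : ℤ) • (T₁.1 - T₂.1) = 0 := by
      rw [smul_sub, h₁, h₂, sub_zero]
    exact Subtype.ext (sub_eq_zero.mp (geomReduction_eq_zero_of_two_smul hΔ hp2 h2 hsub))
  -- both groups have four elements
  have hE : Nat.card (W.geomTorsion ((2 : ℕ) : ℤ)) = 4 :=
    W.card_torsionPoints_eq_sq_holds (AlgebraicClosure ℚ) (n := 2) (by norm_num)
  have h2p : ((2 : ℕ) : AlgebraicClosure (ZMod p)) ≠ 0 := by
    intro h
    apply hp2
    have h' : ((2 : ℕ) : ZMod p) = 0 := by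
      apply (algebraMap (ZMod p) (AlgebraicClosure (ZMod p))).injective
      rw [map_natCast, map_zero]
      exact h
    rw [ZMod.natCast_eq_zero_iff] at h'
    exact (Nat.prime_dvd_prime_iff_eq Fact.out Nat.prime_two).mp h'
  have hEt : Nat.card ((reductionModPrime W p).geomTorsion ((2 : ℕ) : ℤ)) = 4 :=
    (reductionModPrime W p).card_torsionPoints_eq_sq_holds (AlgebraicClosure (ZMod p)) (n := 2) h2p
  haveI : Finite ((reductionModPrime W p).geomTorsion ((2 : ℕ) : ℤ)) := Nat.finite_of_card_ne_zero (by rw [hEt]; decide)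
  have hbij : Function.Bijective f := hinj.bijective_of_nat_card_le (by rw [hE, hEt])
  obtain ⟨⟨T, hT⟩, hTD⟩ := hbij.2 ⟨D, AddSubgroup.torsionBy.nsmul_iff.mpr (by rw [← natCast_zsmul]; exact_mod_cast hD)⟩
  refine ⟨T, ?_, ?_⟩
  · have h := AddSubgroup.torsionBy.nsmul_iff.mp hT
    rw [← natCast_zsmul] at h
    exact_mod_cast h
  · have := congrArg Subtype.val hTD
    simpa [hf] using this

include hmem hv h𝔓 hσ hφ in
/-- **`φ²•red w′ = red w′ + red(bit)`** at an arithmetic Frobenius `σ` (`red(σ•P) = φ•red P`, tree `geomReduction_smul_of_isArithFrobAt`) for the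
frame of §1. [cite: Serre1972, §1.11 Prop. 11] [cite: GrossLMS1991, §6 Prop. 6.2 (proof)] -/
theorem frob_frob_geomReduction_half {w w' t : W.geomPoints} (hw' : (2 : ℤ) • w' = w) (hσw : σ • w = -w + t) (ht : σ • t = t)
    (hodd : Odd (addOrderOf t)) :
    φ • (φ • geomReduction hΔ w') = geomReduction hΔ w' +
      geomReduction hΔ (σ • (σ • w' + w' - (((addOrderOf t + 1) / 2 : ℕ) : ℤ) • t) +
        (σ • w' + w' - (((addOrderOf t + 1) / 2 : ℕ) : ℤ) • t)) := by
  rw [← geomReduction_smul_of_isArithFrobAt hΔ hmem hv h𝔓 hσ hφ, ← geomReduction_smul_of_isArithFrobAt hΔ hmem hv h𝔓 hσ hφ,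
    smul_smul_half_eq_add_bit σ hw' hσw ht hodd, map_add]

include hmem hv h𝔓 hσ hφ in
/-- **THE BIT, READ MOD `λ`: `red w ∈ 2Ẽ(𝔽_{p²})` ⟺ `σ•t₁ + t₁ = 0`.**  Precisely, for `p` odd and `σ²` trivial on `E[2]`:
`(∃ R ∈ Ẽ(𝔽̄_p), φ²•R = R ∧ 2•R = red w) ↔ bit = 0` — a half of `red w` rational over the quadratic extension `𝔽_{p²}` of the residue field (the
residue field of the INERT prime `λ = (p)` of `K`) exists iff the bit vanishes.  (→: such `R` is `red(w′ + T)`, `T ∈ E[2]` by §3's surjectivity, and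
`φ²` moves it by `red(bit)`; `red` is injective on `E[2]`.  ←: `R = red w′`.)  This is the event Kolyvagin's descent localises at a deep prime:
`ord (y_K mod 2^M E(K_λ))`. [cite: GrossLMS1991, §6 Prop. 6.2] [cite: McCallumLMS1991, §4] [cite: SilvermanAEC2009, Prop. VII.3.1(b)] -/
theorem exists_frobSq_fixed_half_iff_bit_eq_zero (hp2 : p ≠ 2) {w w' t : W.geomPoints} (hw' : (2 : ℤ) • w' = w)
    (hσw : σ • w = -w + t) (ht : σ • t = t) (hodd : Odd (addOrderOf t))
    (hσσ : ∀ T : W.geomPoints, (2 : ℤ) • T = 0 → σ • (σ • T) = T) :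
    (∃ R : (reductionModPrime W p).geomPoints, φ • (φ • R) = R ∧ (2 : ℤ) • R = geomReduction hΔ w) ↔
      σ • (σ • w' + w' - (((addOrderOf t + 1) / 2 : ℕ) : ℤ) • t) +
        (σ • w' + w' - (((addOrderOf t + 1) / 2 : ℕ) : ℤ) • t) = 0 := by
  constructor
  · rintro ⟨R, hRfix, hR2⟩
    -- `R − red w′ ∈ Ẽ[2]` is the reduction of some `T ∈ E[2]`
    have hD2 : (2 : ℤ) • (R - geomReduction hΔ w') = 0 := by
      rw [smul_sub, hR2, ← map_zsmul, hw', sub_self]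
    obtain ⟨T, hT2, hTred'⟩ := exists_two_torsion_geomReduction_eq hΔ hp2 (R - geomReduction hΔ w') hD2
    have hRT : R = geomReduction hΔ (w' + T) := by rw [map_add, hTred']; abel
    -- `φ²` moves `red(w′ + T)` by `red(bit)`
    have hmove : φ • (φ • geomReduction hΔ (w' + T)) = geomReduction hΔ (w' + T) +
        geomReduction hΔ (σ • (σ • w' + w' - (((addOrderOf t + 1) / 2 : ℕ) : ℤ) • t) +
          (σ • w' + w' - (((addOrderOf t + 1) / 2 : ℕ) : ℤ) • t)) := by
      rw [← geomReduction_smul_of_isArithFrobAt hΔ hmem hv h𝔓 hσ hφ, ← geomReduction_smul_of_isArithFrobAt hΔ hmem hv h𝔓 hσ hφ,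
        smul_smul_half_add_eq_add_bit σ hw' hσw ht hodd (hσσ T hT2), map_add]
    rw [← hRT, hRfix] at hmove
    have hbit0 : geomReduction hΔ (σ • (σ • w' + w' - (((addOrderOf t + 1) / 2 : ℕ) : ℤ) • t) +
        (σ • w' + w' - (((addOrderOf t + 1) / 2 : ℕ) : ℤ) • t)) = 0 := by
      have := hmove.symm
      rwa [add_eq_left] at this
    -- the bit is `2`-torsion, `red` is injective there
    refine geomReduction_eq_zero_of_two_smul hΔ hp2 ?_ hbit0
    have h2t₁ := two_smul_swapDefect_eq_zero σ hw' hσw hodd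
    rw [smul_add, ← smul_zsmul_geomPoints', h2t₁, smul_zero, zero_add]
  · intro hbit
    refine ⟨geomReduction hΔ w', ?_, by rw [← map_zsmul, hw']⟩
    rw [frob_frob_geomReduction_half hΔ hmem hv h𝔓 hσ hφ hw' hσw ht hodd, hbit, map_zero, add_zero]

include hmem hv h𝔓 hσ hφ in
/-- **BLIND PRIMES**: if `σ` FIXES `E[2]` pointwise (a `τ`-type Frobenius on `Δ > 0`) then `red w ∈ 2Ẽ(𝔽_{p²})` ALWAYS — the positive-depth
bit cannot be read at such a prime. [cite: GrossLMS1991, §6 Prop. 6.2] -/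
theorem exists_frobSq_fixed_half_of_smul_torsion_eq_self (hp2 : p ≠ 2) {w w' t : W.geomPoints} (hw' : (2 : ℤ) • w' = w)
    (hσw : σ • w = -w + t) (ht : σ • t = t) (hodd : Odd (addOrderOf t))
    (hfix : ∀ T : W.geomPoints, (2 : ℤ) • T = 0 → σ • T = T) :
    ∃ R : (reductionModPrime W p).geomPoints, φ • (φ • R) = R ∧ (2 : ℤ) • R = geomReduction hΔ w :=
  (exists_frobSq_fixed_half_iff_bit_eq_zero hΔ hmem hv h𝔓 hσ hφ hp2 hw' hσw ht hodd
    (fun T hT ↦ by rw [hfix T hT, hfix T hT])).mpr (bit_eq_zero_of_smul_torsion_eq_self σ hfix hw' hσw hodd)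

end Reduction

/-! ## §4 At a prime with even `a_p` the square of Frobenius is trivial on `E[2]` -/

section EvenTrace

variable {p : ℕ} [Fact p.Prime] {W : WeierstrassCurve ℚ} [W.IsGloballyMinimal] [W.IsElliptic]
  (hΔ : ¬ (p : ℤ) ∣ minimalDiscriminantInt W)
  {𝔓 : Ideal (absIntegers (𝓞 ℚ) ℚ)}
  (hmem : ∀ x : absIntegers (𝓞 ℚ) ℚ, x ∈ 𝔓 ↔ (x : AlgebraicClosure ℚ) ∈ (placeOver p).nonunits)
  {v : HeightOneSpectrum (𝓞 ℚ)} (hv : (primesEquiv v : ℕ) = p) (h𝔓 : 𝔓 ∈ v.primesAbove)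
  {σ : absoluteGaloisGroup ℚ} (hσ : IsArithFrobAt (𝓞 ℚ) σ 𝔓)

omit [W.IsElliptic] in
include hΔ in
/-- **Manin's relation on `Ẽ[2]` at an odd prime with even `a_p`: `φ²R = R`** (`φ² − a_pφ + p = 0` on `Ẽ(𝔽̄_p)`, tree
`frobenius_frobenius_sub_trace_smul_add_card_smul`; `a_p•φR = 0` and `p•R = R` on `2`-torsion). [cite: SilvermanAEC2009, Thm. V.2.3.1] -/
theorem frob_frob_eq_self_of_even_frobeniusTrace (hp2 : p ≠ 2) (ha : (2 : ℤ) ∣ W.frobeniusTrace p)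
    {φ : absoluteGaloisGroup (ZMod p)} (hφ : ∀ x : AlgebraicClosure (ZMod p), φ • x = x ^ p)
    (R : (reductionModPrime W p).geomPoints) (hR : (2 : ℤ) • R = 0) : φ • (φ • R) = R := by
  haveI : (reductionModPrime W p).IsElliptic := isElliptic_reductionModPrime W hΔ
  have hcard : Nat.card (ZMod p) = p := Nat.card_zmod p
  have hφ' : ∀ x : AlgebraicClosure (ZMod p), φ • x = x ^ Nat.card (ZMod p) := by rw [hcard]; exact hφ
  have hrel := (reductionModPrime W p).frobenius_frobenius_sub_trace_smul_add_card_smul hφ' R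
  rw [hcard, ← frobeniusTrace_eq_sub_natCard_reductionModPrime W p] at hrel
  -- `a_p • φR = 0`
  obtain ⟨k, hk⟩ := ha
  have h2φ : (2 : ℤ) • (φ • R) = 0 := by
    rw [smul_comm, hR, smul_zero]
  have haφ : W.frobeniusTrace p • (φ • R) = 0 := by rw [hk, mul_comm, mul_smul, h2φ, smul_zero]
  -- `p • R = R` (`p` odd)
  obtain ⟨m, hm⟩ := (Fact.out : p.Prime).eq_two_or_odd'.resolve_left hp2
  have hpR : ((p : ℕ) : ℤ) • R = R := by
    have hp' : ((p : ℕ) : ℤ) = (m : ℤ) * 2 + 1 := by rw [hm]; push_cast; ring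
    rw [hp', add_smul, one_smul, mul_smul, hR, smul_zero, zero_add]
  rw [haφ, sub_zero, hpR] at hrel
  -- `φφR + R = 0`, and `−R = R`
  have hneg : -R = R := by rw [neg_eq_iff_add_eq_zero, ← two_smul ℤ, hR]
  exact (eq_neg_of_add_eq_zero_left hrel).trans hneg

include hΔ hmem hv h𝔓 hσ in
/-- **`σ²` is trivial on `E[2]` at an arithmetic Frobenius of an odd good prime with EVEN `a_p`** (every Zhang–Kolyvagin prime at `2` has
`2 ∣ a_ℓ`): `red(σ²T) = φ² red T = red T` and `red` is injective on `E[2]`.  So §1–§3 apply at every deep prime with no hypothesis on the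
conjugacy class beyond parity. [cite: SilvermanAEC2009, Thm. V.2.3.1, Prop. VII.3.1(b)] [cite: WZhang2014, Notations (Kolyvagin primes)] -/
theorem smul_smul_eq_self_of_even_frobeniusTrace (hp2 : p ≠ 2) (ha : (2 : ℤ) ∣ W.frobeniusTrace p)
    (T : W.geomPoints) (hT : (2 : ℤ) • T = 0) : σ • (σ • T) = T := by
  obtain ⟨φ, hφ0⟩ := exists_frobenius_absoluteGaloisGroup (ZMod p)
  have hφ : ∀ x : AlgebraicClosure (ZMod p), φ • x = x ^ p := by
    intro x; rw [hφ0 x, Nat.card_zmod]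
  have hR2 : (2 : ℤ) • geomReduction hΔ T = 0 := by rw [← map_zsmul, hT, map_zero]
  have hred : geomReduction hΔ (σ • (σ • T)) = geomReduction hΔ T := by
    rw [geomReduction_smul_of_isArithFrobAt hΔ hmem hv h𝔓 hσ hφ, geomReduction_smul_of_isArithFrobAt hΔ hmem hv h𝔓 hσ hφ,
      frob_frob_eq_self_of_even_frobeniusTrace hΔ hp2 ha hφ _ hR2]
  have hsub : geomReduction hΔ (σ • (σ • T) - T) = 0 := by rw [map_sub, hred, sub_self]
  have h2 : (2 : ℤ) • (σ • (σ • T) - T) = 0 := by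
    rw [smul_sub, ← smul_zsmul_geomPoints', ← smul_zsmul_geomPoints', hT, smul_zero, smul_zero, sub_zero]
  exact sub_eq_zero.mp (geomReduction_eq_zero_of_two_smul hΔ hp2 h2 hsub)

include hΔ hmem hv h𝔓 hσ in
/-- **THE K₄⁺ READING, ASSEMBLED**: at an arithmetic Frobenius `σ` of an odd good prime with even `a_p`, for the frame `2w′ = w`, `σw = −w + t`,
`σt = t`, `t` of odd order: `red w` has a half rational over `𝔽_{p²}` iff the bit `σ•t₁ + t₁` vanishes; and if `σ` fixes `E[2]` pointwise the
half always exists.  (Transposition-type `σ` — the registered K₄⁺ clause `∃ u : E[2], σ•u ≠ u` — is where the bit is live, §2.)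
[cite: GrossLMS1991, §6 Prop. 6.2] [cite: SilvermanAEC2009, Thm. V.2.3.1, Prop. VII.3.1(b)] -/
theorem exists_frobSq_fixed_half_iff_of_even_frobeniusTrace (hp2 : p ≠ 2) (ha : (2 : ℤ) ∣ W.frobeniusTrace p)
    {φ : absoluteGaloisGroup (ZMod p)} (hφ : ∀ x : AlgebraicClosure (ZMod p), φ • x = x ^ p)
    {w w' t : W.geomPoints} (hw' : (2 : ℤ) • w' = w) (hσw : σ • w = -w + t) (ht : σ • t = t) (hodd : Odd (addOrderOf t)) :
    (∃ R : (reductionModPrime W p).geomPoints, φ • (φ • R) = R ∧ (2 : ℤ) • R = geomReduction hΔ w) ↔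
      σ • (σ • w' + w' - (((addOrderOf t + 1) / 2 : ℕ) : ℤ) • t) +
        (σ • w' + w' - (((addOrderOf t + 1) / 2 : ℕ) : ℤ) • t) = 0 :=
  exists_frobSq_fixed_half_iff_bit_eq_zero hΔ hmem hv h𝔓 hσ hφ hp2 hw' hσw ht hodd
    (fun T hT ↦ smul_smul_eq_self_of_even_frobeniusTrace hΔ hmem hv h𝔓 hσ hp2 ha T hT)

end EvenTrace

end Summit.BirchSwinnertonDyer.BirchSwinnertonDyer.Theorems.GenusSupplyNarrow.SwapRead

end
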